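import Summits.ResolutionOfSingularities.ResolutionOfSingularities.Theorems.SubmaximalShadowCharts
import HarnessLib

/-!
# Submaximal shadow cut — KERNELS (lens-4 g46, node «SubmaximalCut», slice S4)

LAW E `noTower_submaximalSurfaceHugging`: NO infinite forced tower of weight `n ≥ 1` hugs a regular surface germ `H`
CARRYING the marked ideal in its `(n-1)`-st power (`I_m ⊆ 𝔭^(n-1)`, `𝔭 = H_{x_m}`, `𝒪/𝔭` regular of dimension two).

MECHANISM (Loewy descent of the level shadow).  Along the tower keep the SHADOW FRAME (`ShadowFrame`): regular
parameters `u` with `(u) = 𝔭_i` (the strict transform of `H`), `I_i ⊆ (u)^(n-1)`, and `𝔪^λ ⊆ 𝔍_i`, `𝔍_i` the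
level-`(n-1)` shadow.  ISOLATION of `x_i` in `Top(I_i, n)` makes `𝔍_i` `𝔪`-primary (`levelShadow_not_le_prime`,
from `tower_not_map_le_pow`); the NEXT centre lies on the strict transform of `H` and isolation there forces
NON-DEGENERACY `𝔍_i ⊄ 𝔪² + 𝔭_i` (else the transported shadow sits inside the height-`(c+1)` prime `(g, u')`);
an element `a₀ ∈ 𝔍_i ∖ (𝔪² + 𝔭_i)` is then a regular parameter, the next centre lies in the chart of the
complementary parameter `b`, and there `𝔪'^(λ-1) ⊆ 𝔍_{i+1}` (`shadowFrame_succ`).  At `λ = 0` the shadow would be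
the unit ideal, contradicting `I_i ⊆ 𝔪^n` (`shadowFrame_zero_elim`).  The chart algebra is `chart_transport`
(slice S3, Rees chart of the point blow-up at a regular point).

All statements sorry-free over landed modules. [cite: Hironaka1964, Ch. III §3; Matsumura1987, Thm. 14.2, §16;
CossartJannsenSaito2009, Thm. 5.31 (isolation along permissible towers)]
-/

set_option linter.dupNamespace false

open CategoryTheory CategoryTheory.Limits AlgebraicGeometry TopologicalSpace IsLocalRing
open Literature.AlgebraicGeometry.Resolution Scheme.IdealSheafData
open Summit.ResolutionOfSingularities.ResolutionOfSingularities.Theorems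
open ForcedTowerClasses DivergentTowerClasses MonomialTowerClasses
open HugDimensionClasses SurfaceShadowClasses SurfaceShadowKernels AbsoluteContactClasses
open Summit.ResolutionOfSingularities.ResolutionOfSingularities.Theses

universe u

namespace Summit.ResolutionOfSingularities.ResolutionOfSingularities.Theorems.HugValuationCut

/-! ## §1 The shadow frame along a forced tower: primary shadow, START, END, STEP -/

section Tower

variable {k : Type} [Field k]

/-- **(P2) the shadow lies in no prime `𝔔 ≠ 𝔪` above `𝔭`**: else `I_i ⊆ 𝔍·𝔭^(n-1) ⊆ 𝔔^n`, against the isolation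
of `x_i` in `Top(I_i, n)` (`tower_not_map_le_pow`). [cite: CossartJannsenSaito2009, Thm. 5.31; Matsumura1987, §16] -/
theorem levelShadow_not_le_prime (T : ForcedTower) {n : ℕ} (hD : IsDatum n (T.D 0)) (i : ℕ) {ℓ : ℕ}
    (hℓ : ℓ + 1 = n) {c : ℕ} {u : Fin c → (T.St i).presheaf.stalk (T.pt i)} (hu : IsRsopPart u)
    (hIp : stalkIdeal (T.D i).ideal (T.pt i) ≤ Ideal.span (Set.range u) ^ ℓ)
    (𝔔 : Ideal ((T.St i).presheaf.stalk (T.pt i))) [𝔔.IsPrime] (h𝔔 : 𝔔 ≠ maximalIdeal _)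
    (h𝔭𝔔 : Ideal.span (Set.range u) ≤ 𝔔) :
    ¬ levelShadow (Ideal.span (Set.range u)) (stalkIdeal (T.D i).ideal (T.pt i)) ℓ ≤ 𝔔 := by
  intro h
  haveI := hu.isRegularLocalRing
  have h1 : stalkIdeal (T.D i).ideal (T.pt i) ≤ 𝔔 ^ n := by
    rw [← hℓ, pow_succ']
    exact (le_levelShadow_mul_pow hu.isQuasiRegular hIp).trans (Ideal.mul_mono h (Ideal.pow_right_mono h𝔭𝔔 ℓ))
  refine tower_not_map_le_pow T hD i 𝔔 h𝔔 ?_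
  calc (stalkIdeal (T.D i).ideal (T.pt i)).map (algebraMap _ (Localization.AtPrime 𝔔))
      ≤ (𝔔 ^ n).map (algebraMap _ (Localization.AtPrime 𝔔)) := Ideal.map_mono h1
    _ = maximalIdeal (Localization.AtPrime 𝔔) ^ n := by
        rw [Ideal.map_pow, Localization.AtPrime.map_eq_maximalIdeal]

/-- **the shadow is `𝔪`-primary**: `𝔪^λ ⊆ 𝔍 ⊆ 𝔪` for some `λ`. [cite: Matsumura1987, §16; AtiyahMacdonald1969, Cor. 7.16] -/
theorem exists_pow_le_levelShadow (T : ForcedTower) (g : T.St 0 ⟶ Spec (.of k)) (hB : IsBase (T.St 0) g) {n : ℕ}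
    (hD : IsDatum n (T.D 0)) (i : ℕ) {ℓ : ℕ} (hℓ : ℓ + 1 = n) {c : ℕ}
    {u : Fin c → (T.St i).presheaf.stalk (T.pt i)} (hu : IsRsopPart u)
    (hIp : stalkIdeal (T.D i).ideal (T.pt i) ≤ Ideal.span (Set.range u) ^ ℓ) :
    ∃ la : ℕ, maximalIdeal _ ^ la ≤ levelShadow (Ideal.span (Set.range u)) (stalkIdeal (T.D i).ideal (T.pt i)) ℓ := by
  haveI := (tower_isLocallyNoetherian_isRegular T g hB i).2 (T.pt i)
  refine exists_maximalIdeal_pow_le fun 𝔔 h𝔔 h𝔍𝔔 => ?_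
  by_contra hne
  exact levelShadow_not_le_prime T hD i hℓ hu hIp 𝔔 hne ((le_levelShadow _ _ _).trans h𝔍𝔔) h𝔍𝔔

/-- **START**: a submaximally hugged regular surface germ yields a shadow frame at stage `m`.
[cite: Matsumura1987, Thm. 14.2, §16] -/
theorem shadowFrame_start (T : ForcedTower) (g : T.St 0 ⟶ Spec (.of k)) (hB : IsBase (T.St 0) g) {n : ℕ}
    (hD : IsDatum n (T.D 0)) (hn : 1 ≤ n) {m : ℕ} {H : (T.St m).IdealSheafData} (hH : HugsGerm T m H)
    (hd2 : ringKrullDim ((T.St m).presheaf.stalk (T.pt m) ⧸ stalkIdeal H (T.pt m)) = (2 : WithBot ℕ∞))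
    [IsRegularLocalRing ((T.St m).presheaf.stalk (T.pt m) ⧸ stalkIdeal H (T.pt m))]
    (hIP : stalkIdeal (T.D m).ideal (T.pt m) ≤ stalkIdeal H (T.pt m) ^ ((T.D m).mult - 1)) :
    ∃ c la : ℕ, ShadowFrame T n m H 0 c la := by
  haveI := (tower_isLocallyNoetherian_isRegular T g hB m).2 (T.pt m)
  have hle : stalkIdeal H (T.pt m) ≤ maximalIdeal _ := (mem_support_iff_stalkIdeal_le _ _).mp (hH.2 0)
  obtain ⟨c, u, hu, hHu⟩ := exists_isRsopPart_of_isRegularLocalRing_quotient hle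
  have hℓ : n - 1 + 1 = n := Nat.sub_add_cancel hn
  have hdim : ringKrullDim ((T.St m).presheaf.stalk (T.pt m)) = (c + 2 : ℕ) := by
    have h := hu.ringKrullDim_quotient_add
    rw [← hHu, hd2] at h
    rw [← h]
    push_cast
    rw [add_comm]
  have hIp : stalkIdeal (T.D m).ideal (T.pt m) ≤ Ideal.span (Set.range u) ^ (n - 1) := by
    rw [← hHu, ← tower_mult_eq T hD m]; exact hIP
  obtain ⟨la, hla⟩ := exists_pow_le_levelShadow T g hB hD m hℓ hu hIp
  exact ⟨c, la, u, hu, hHu.symm, hdim, hIp, hla⟩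

/-- **END**: a shadow frame with exponent `λ = 0` is absurd (`𝔍 = (1)` but `𝔍 ⊆ 𝔪`). [cite: Matsumura1987, §16] -/
theorem shadowFrame_zero_elim (T : ForcedTower) {n : ℕ} (hD : IsDatum n (T.D 0)) (hn : 1 ≤ n) {m : ℕ}
    {H : (T.St m).IdealSheafData} {j c : ℕ} (h : ShadowFrame T n m H j c 0) : False := by
  obtain ⟨u, hu, -, -, hIp, hla⟩ := h
  have hℓ : n - 1 + 1 = n := Nat.sub_add_cancel hn
  have h𝔍m := levelShadow_le_maximalIdeal hu (by rw [hℓ]; exact tower_stalkIdeal_le_pow T hD (m + j)) hIp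
  rw [pow_zero, Ideal.one_eq_top, top_le_iff] at hla
  rw [hla] at h𝔍m
  exact (maximalIdeal.isMaximal _).ne_top (top_le_iff.mp h𝔍m)

/-- **STEP** (the heart of LAW E): a shadow frame with exponent `λ + 1` at stage `m + j` yields one with exponent `λ`
at stage `m + j + 1`.  See the module docstring for the mechanism. [cite: Hironaka1964, Ch. III §3;
Matsumura1987, Thm. 14.2, §16; CossartJannsenSaito2009, Thm. 5.31] -/
theorem shadowFrame_succ (T : ForcedTower) (g : T.St 0 ⟶ Spec (.of k)) (hB : IsBase (T.St 0) g) {n : ℕ}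
    (hD : IsDatum n (T.D 0)) (hn : 1 ≤ n) {m : ℕ} {H : (T.St m).IdealSheafData} (hH : HugsGerm T m H)
    {j c la : ℕ} (h : ShadowFrame T n m H j c (la + 1)) : ShadowFrame T n m H (j + 1) c la := by
  obtain ⟨u, hu₀, hpu₀, hdim₀, hIp₀, hla₀⟩ := h
  -- re-elaborate the frame hypotheses in this context (the `def` abstracts instance proofs into constants that
  -- `generalize` cannot see through)
  have hu : IsRsopPart u := hu₀
  have hpu : Ideal.span (Set.range u) = stalkIdeal (strictIter T m H j) (T.pt (m + j)) := hpu₀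
  have hdim : ringKrullDim ((T.St (m + j)).presheaf.stalk (T.pt (m + j))) = (c + 2 : ℕ) := hdim₀
  have hIp : stalkIdeal (T.D (m + j)).ideal (T.pt (m + j)) ≤ Ideal.span (Set.range u) ^ (n - 1) := hIp₀
  have hla : maximalIdeal _ ^ (la + 1) ≤
      levelShadow (Ideal.span (Set.range u)) (stalkIdeal (T.D (m + j)).ideal (T.pt (m + j))) (n - 1) := hla₀
  clear hu₀ hpu₀ hdim₀ hIp₀ hla₀
  have hℓ : n - 1 + 1 = n := Nat.sub_add_cancel hn
  -- stage `m + j`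
  have hIm : stalkIdeal (T.D (m + j)).ideal (T.pt (m + j)) ≤ maximalIdeal _ ^ (n - 1 + 1) := by
    rw [hℓ]; exact tower_stalkIdeal_le_pow T hD (m + j)
  have hZst : stalkIdeal (T.centre (m + j)) (T.pt (m + j)) = maximalIdeal _ := by
    rw [tower_centre_eq_vanishingIdeal T (m + j)]
    exact stalkIdeal_vanishingIdeal_singleton (T.isClosed_pt _)
  have hDeq : (T.D (m + (j + 1))).ideal =
      controlledTransform (T.π (m + j)) (T.centre (m + j)) (T.D (m + j)).ideal n := by
    show (T.D (m + j + 1)).ideal = _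
    rw [T.transform_eq (m + j), MarkedIdeal.transform_ideal, tower_mult_eq T hD (m + j)]
  -- stage `m + j + 1`
  haveI hX' : IsLocallyNoetherian (T.St (m + j + 1)) := (tower_isLocallyNoetherian_isRegular T g hB (m + j + 1)).1
  haveI hS : IsRegularLocalRing ((T.St (m + j + 1)).presheaf.stalk (T.pt (m + (j + 1)))) :=
    (tower_isLocallyNoetherian_isRegular T g hB (m + j + 1)).2 _
  have hdimS : ringKrullDim ((T.St (m + j + 1)).presheaf.stalk (T.pt (m + (j + 1)))) = (c + 2 : ℕ) := by
    have h1 := tower_ringKrullDim_pt_eq T g hB hD hn (m + (j + 1))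
    have h2 := tower_ringKrullDim_pt_eq T g hB hD hn (m + j)
    rw [hdim] at h2
    exact h1.trans h2.symm
  have hrankS : (maximalIdeal ((T.St (m + j + 1)).presheaf.stalk (T.pt (m + (j + 1))))).spanFinrank = c + 2 := by
    have h1 := IsRegularLocalRing.spanFinrank_maximalIdeal (R := (T.St (m + j + 1)).presheaf.stalk (T.pt (m + (j + 1))))
    rw [hdimS] at h1
    exact_mod_cast h1
  have hx'K : T.pt (m + (j + 1)) ∈
      ((strictTransformIdeal (T.π (m + j)) (T.centre (m + j)) (strictIter T m H j)).support : Set _) := hH.2 (j + 1)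
  have hI'm : stalkIdeal (T.D (m + (j + 1))).ideal (T.pt (m + (j + 1))) ≤ maximalIdeal _ ^ (n - 1 + 1) := by
    rw [hℓ]; exact tower_stalkIdeal_le_pow T hD (m + (j + 1))
  -- move all stage-`(m + j)` data to the base point `π x'`
  have hy : (T.π (m + j)).base (T.pt (m + (j + 1))) = T.pt (m + j) := T.pt_map (m + j)
  generalize hx : T.pt (m + j) = x at u hu hpu hdim hIp hla hIm hZst hy
  subst hy
  haveI hR : IsRegularLocalRing ((T.St (m + j)).presheaf.stalk ((T.π (m + j)).base (T.pt (m + (j + 1))))) :=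
    (tower_isLocallyNoetherian_isRegular T g hB (m + j)).2 _
  have h𝔍m := levelShadow_le_maximalIdeal hu hIm hIp
  have hrank : (maximalIdeal ((T.St (m + j)).presheaf.stalk ((T.π (m + j)).base (T.pt (m + (j + 1)))))).spanFinrank = c + 2 := by
    have h1 := IsRegularLocalRing.spanFinrank_maximalIdeal (R := (T.St (m + j)).presheaf.stalk ((T.π (m + j)).base (T.pt (m + (j + 1)))))
    rw [hdim] at h1
    exact_mod_cast h1
  -- the image of the stage-`(m+j)` maximal ideal and shadow under any chart
  have himage : ∀ {d : ℕ} (z : Fin d → (T.St (m + j)).presheaf.stalk ((T.π (m + j)).base (T.pt (m + (j + 1)))))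
      (hz : Ideal.span (Set.range z) = maximalIdeal _) (j₀ : Fin d) (e : Fin d → _)
      (hzt : ∀ t, ((T.π (m + j)).stalkMap (T.pt (m + (j + 1)))).hom (z t) =
        ((T.π (m + j)).stalkMap (T.pt (m + (j + 1)))).hom (z j₀) * e t),
      (maximalIdeal _).map ((T.π (m + j)).stalkMap (T.pt (m + (j + 1)))).hom =
        Ideal.span {((T.π (m + j)).stalkMap (T.pt (m + (j + 1)))).hom (z j₀)} := by
    intro d z hz j₀ e hzt
    rw [← hz, Ideal.map_span]
    apply le_antisymm
    · rw [Ideal.span_le]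
      rintro _ ⟨_, ⟨l, rfl⟩, rfl⟩
      rw [SetLike.mem_coe, Ideal.mem_span_singleton']
      exact ⟨e l, by rw [mul_comm]; exact (hzt l).symm⟩
    · exact (Ideal.span_singleton_le_iff_mem _).mpr (Ideal.subset_span ⟨z j₀, ⟨j₀, rfl⟩, rfl⟩)
  -- NON-DEGENERACY: the shadow is not inside `𝔪² + 𝔭`
  have hnd : ∃ a₀ ∈ levelShadow (Ideal.span (Set.range u)) (stalkIdeal (T.D (m + j)).ideal
      ((T.π (m + j)).base (T.pt (m + (j + 1))))) (n - 1), a₀ ∉ maximalIdeal _ ^ 2 ⊔ Ideal.span (Set.range u) := by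
    by_contra hdeg
    push Not at hdeg
    obtain ⟨e₀, zz, hzrank, hzz, hzzu⟩ := hu.exists_rsop
    have hKz : Ideal.span (Set.range (zz ∘ Fin.castAdd e₀)) = stalkIdeal (strictIter T m H j) _ := by
      rw [← hpu]; congr 1; ext a; constructor
      · rintro ⟨t, rfl⟩; exact ⟨t, (hzzu t).symm⟩
      · rintro ⟨t, rfl⟩; exact ⟨t, hzzu t⟩
    obtain ⟨j₀, e, hj₀, hgnzd, hzt, hsnoc, h𝔭', hI', -⟩ :=
      chart_transport (T.π (m + j)) (T.centre (m + j)) (strictIter T m H j) (T.D (m + j)).ideal (T.isBlowup (m + j))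
        (T.pt (m + (j + 1))) hZst zz hzz hzrank (Fin.castAdd e₀) (Fin.castAdd_injective _ _) hKz hx'K n
    -- the new frame data `u' = e ∘ castAdd e₀`, `g = σ zz_{j₀}`
    have hu' : IsRsopPart (e ∘ Fin.castAdd e₀) := by
      have h1 := hsnoc.comp Fin.castSucc (Fin.castSucc_injective _)
      have h2 : (Fin.snoc (e ∘ Fin.castAdd e₀) (((T.π (m + j)).stalkMap (T.pt (m + (j + 1)))).hom (zz j₀)) :
          Fin (c + 1) → _) ∘ Fin.castSucc = e ∘ Fin.castAdd e₀ := by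
        funext t; simp only [Function.comp_apply, Fin.snoc_castSucc]
      rwa [h2] at h1
    have hI'p : stalkIdeal (T.D (m + (j + 1))).ideal (T.pt (m + (j + 1))) ≤
        Ideal.span (Set.range (e ∘ Fin.castAdd e₀)) ^ (n - 1) := by
      rw [hDeq]
      refine transform_le_pow _ u (e ∘ Fin.castAdd e₀) _ hgnzd (fun t => ?_) _ _ (n - 1) hIp
        (fun y => by rw [hℓ]; exact hI' y) hu.isQuasiRegular (h𝔍m.trans ?_)
      · rw [Function.comp_apply, ← hzt, hzzu]
      · rw [← Ideal.map_le_iff_le_comap, himage zz hzz j₀ e hzt]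
    -- the prime `𝔔 = (u', g)` contains the transported shadow
    set 𝔔 : Ideal ((T.St (m + j + 1)).presheaf.stalk (T.pt (m + (j + 1)))) :=
      Ideal.span (Set.range (Fin.snoc (e ∘ Fin.castAdd e₀)
        (((T.π (m + j)).stalkMap (T.pt (m + (j + 1)))).hom (zz j₀)) : Fin (c + 1) → _)) with h𝔔def
    haveI h𝔔p : 𝔔.IsPrime := hsnoc.isPrime_span_range
    have h𝔔eq : 𝔔 = Ideal.span (Set.range (e ∘ Fin.castAdd e₀)) ⊔
        Ideal.span {((T.π (m + j)).stalkMap (T.pt (m + (j + 1)))).hom (zz j₀)} := span_range_snoc _ _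
    have h𝔔ne : 𝔔 ≠ maximalIdeal _ := by
      intro h𝔔
      have h1 := hsnoc.ringKrullDim_quotient_add
      rw [← h𝔔def, h𝔔, hdimS] at h1
      letI : Field (((T.St (m + j + 1)).presheaf.stalk (T.pt (m + (j + 1)))) ⧸
          maximalIdeal ((T.St (m + j + 1)).presheaf.stalk (T.pt (m + (j + 1))))) :=
        Ideal.Quotient.field _
      rw [ringKrullDim_eq_zero_of_field, zero_add] at h1
      have : c + 1 = c + 2 := by exact_mod_cast h1
      omega
    have h𝔍' : levelShadow (Ideal.span (Set.range (e ∘ Fin.castAdd e₀)))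
        (stalkIdeal (T.D (m + (j + 1))).ideal (T.pt (m + (j + 1)))) (n - 1) ≤ 𝔔 := by
      refine levelShadow_le (h𝔔eq ▸ le_sup_left) ?_
      rw [hDeq]
      refine transform_le_mul_pow_of_levelShadow_le _ u (e ∘ Fin.castAdd e₀) _ hgnzd (fun t => ?_) _ _ (n - 1)
        hIp (fun y => by rw [hℓ]; exact hI' y) hu.isQuasiRegular ?_
      · rw [Function.comp_apply, ← hzt, hzzu]
      · -- `𝔍 ⊆ 𝔪² + 𝔭` maps into `g·𝔔 = g·((u') + (g))`
        intro a ha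
        rw [Ideal.mem_comap]
        have ha' := hdeg a ha
        have hm2 : (maximalIdeal _ ^ 2).map ((T.π (m + j)).stalkMap (T.pt (m + (j + 1)))).hom ≤
            Ideal.span {((T.π (m + j)).stalkMap (T.pt (m + (j + 1)))).hom (zz j₀)} * 𝔔 := by
          rw [Ideal.map_pow, himage zz hzz j₀ e hzt, pow_two]
          exact Ideal.mul_mono_right (h𝔔eq ▸ le_sup_right)
        have hp : (Ideal.span (Set.range u)).map ((T.π (m + j)).stalkMap (T.pt (m + (j + 1)))).hom ≤
            Ideal.span {((T.π (m + j)).stalkMap (T.pt (m + (j + 1)))).hom (zz j₀)} * 𝔔 := by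
          rw [Ideal.map_span, Ideal.span_le]
          rintro _ ⟨_, ⟨t, rfl⟩, rfl⟩
          rw [SetLike.mem_coe, ← hzzu t, hzt (Fin.castAdd e₀ t)]
          exact Ideal.mul_mem_mul (Ideal.mem_span_singleton_self _)
            (h𝔔eq ▸ Ideal.mem_sup_left (Ideal.subset_span (s := Set.range (e ∘ Fin.castAdd e₀)) (Set.mem_range_self t)))
        have h3 : (maximalIdeal _ ^ 2 ⊔ Ideal.span (Set.range u)).map ((T.π (m + j)).stalkMap (T.pt (m + (j + 1)))).hom ≤
            Ideal.span {((T.π (m + j)).stalkMap (T.pt (m + (j + 1)))).hom (zz j₀)} * 𝔔 := by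
          rw [Ideal.map_sup]; exact sup_le hm2 hp
        exact h3 (Ideal.mem_map_of_mem _ ha')
    exact levelShadow_not_le_prime T hD (m + (j + 1)) hℓ hu' hI'p 𝔔 h𝔔ne (h𝔔eq ▸ le_sup_left) h𝔍'
  -- THE DESCENT through an adapted regular system of parameters `(u, a₀, b)`
  obtain ⟨a₀, ha₀𝔍, ha₀⟩ := hnd
  obtain ⟨z, hzspan, hzrank, hzu, hza₀⟩ := exists_rsop_adapted hu hdim (h𝔍m ha₀𝔍) ha₀
  have hι : Function.Injective (fun t : Fin c => Fin.castSucc (Fin.castSucc t) : Fin c → Fin (c + 1 + 1)) :=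
    fun a b h => Fin.castSucc_injective _ (Fin.castSucc_injective _ h)
  have hKz : Ideal.span (Set.range (z ∘ fun t : Fin c => Fin.castSucc (Fin.castSucc t))) =
      stalkIdeal (strictIter T m H j) _ := by
    rw [← hpu]; congr 1; ext a; constructor
    · rintro ⟨t, rfl⟩; exact ⟨t, (hzu t).symm⟩
    · rintro ⟨t, rfl⟩; exact ⟨t, hzu t⟩
  obtain ⟨j₀, e, hj₀, hgnzd, hzt, hsnoc, h𝔭', hI', hbig⟩ :=
    chart_transport (T.π (m + j)) (T.centre (m + j)) (strictIter T m H j) (T.D (m + j)).ideal (T.isBlowup (m + j))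
      (T.pt (m + (j + 1))) hZst z hzspan hzrank _ hι hKz hx'K n
  have hue : ∀ t, ((T.π (m + j)).stalkMap (T.pt (m + (j + 1)))).hom (u t) =
      ((T.π (m + j)).stalkMap (T.pt (m + (j + 1)))).hom (z j₀) * (e ∘ fun t => Fin.castSucc (Fin.castSucc t)) t :=
    fun t => by rw [Function.comp_apply, ← hzt, hzu]
  have hu' : IsRsopPart (e ∘ fun t : Fin c => Fin.castSucc (Fin.castSucc t)) := by
    have h1 := hsnoc.comp Fin.castSucc (Fin.castSucc_injective _)
    have h2 : (Fin.snoc (e ∘ fun t : Fin c => Fin.castSucc (Fin.castSucc t))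
        (((T.π (m + j)).stalkMap (T.pt (m + (j + 1)))).hom (z j₀)) : Fin (c + 1) → _) ∘ Fin.castSucc =
        e ∘ fun t : Fin c => Fin.castSucc (Fin.castSucc t) := by
      funext t; simp only [Function.comp_apply, Fin.snoc_castSucc]
    rwa [h2] at h1
  have h𝔍g : levelShadow (Ideal.span (Set.range u)) (stalkIdeal (T.D (m + j)).ideal
      ((T.π (m + j)).base (T.pt (m + (j + 1))))) (n - 1) ≤
      (Ideal.span {((T.π (m + j)).stalkMap (T.pt (m + (j + 1)))).hom (z j₀)}).comap
        ((T.π (m + j)).stalkMap (T.pt (m + (j + 1)))).hom := by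
    rw [← Ideal.map_le_iff_le_comap, ← himage z hzspan j₀ e hzt]; exact Ideal.map_mono h𝔍m
  have hI'p : stalkIdeal (T.D (m + (j + 1))).ideal (T.pt (m + (j + 1))) ≤
      Ideal.span (Set.range (e ∘ fun t : Fin c => Fin.castSucc (Fin.castSucc t))) ^ (n - 1) := by
    rw [hDeq]
    exact transform_le_pow _ u _ _ hgnzd hue _ _ (n - 1) hIp (fun y => by rw [hℓ]; exact hI' y)
      hu.isQuasiRegular h𝔍g
  -- TRANSPORT UP: `σ(𝔍) ⊆ g·𝔍'`
  have hup := levelShadow_le_comap_mul _ u _ _ hgnzd hue _ _ (n - 1) hIp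
    (fun y => by rw [hℓ]; exact hI' y) hu.isQuasiRegular hu'.isQuasiRegular h𝔍g
  rw [← hDeq] at hup
  have h𝔍'm : levelShadow (Ideal.span (Set.range (e ∘ fun t : Fin c => Fin.castSucc (Fin.castSucc t))))
      (stalkIdeal (T.D (m + (j + 1))).ideal (T.pt (m + (j + 1)))) (n - 1) ≤ maximalIdeal _ :=
    levelShadow_le_maximalIdeal hu' hI'm hI'p
  -- the exceptional index is the complementary parameter `b`, not `a₀`
  have hj₀a : j₀ ≠ Fin.castSucc (Fin.last c) := by
    intro hj
    have h1 := hup ha₀𝔍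
    rw [Ideal.mem_comap, ← hza₀, ← hj] at h1
    have h2 : (1 : (T.St (m + j + 1)).presheaf.stalk (T.pt (m + (j + 1)))) ∈ levelShadow
        (Ideal.span (Set.range (e ∘ fun t : Fin c => Fin.castSucc (Fin.castSucc t))))
        (stalkIdeal (T.D (m + (j + 1))).ideal (T.pt (m + (j + 1)))) (n - 1) := by
      refine mem_of_mul_mem_span_singleton_mul _ hgnzd ?_
      rw [mul_one]; exact h1
    exact (maximalIdeal.isMaximal _).ne_top (Ideal.eq_top_of_isUnit_mem _ (h𝔍'm h2) isUnit_one)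
  -- `x'' = e_{a₀} ∈ 𝔍'`
  have hxmem : e (Fin.castSucc (Fin.last c)) ∈ levelShadow
      (Ideal.span (Set.range (e ∘ fun t : Fin c => Fin.castSucc (Fin.castSucc t))))
      (stalkIdeal (T.D (m + (j + 1))).ideal (T.pt (m + (j + 1)))) (n - 1) := by
    have h1 := hup ha₀𝔍
    rw [Ideal.mem_comap, ← hza₀, hzt (Fin.castSucc (Fin.last c))] at h1
    exact mem_of_mul_mem_span_singleton_mul _ hgnzd h1
  -- `g^λ ∈ 𝔍'` (from `z_{j₀}^(λ+1) ∈ 𝔪^(λ+1) ⊆ 𝔍`)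
  have hgpow : ((T.π (m + j)).stalkMap (T.pt (m + (j + 1)))).hom (z j₀) ^ la ∈ levelShadow
      (Ideal.span (Set.range (e ∘ fun t : Fin c => Fin.castSucc (Fin.castSucc t))))
      (stalkIdeal (T.D (m + (j + 1))).ideal (T.pt (m + (j + 1)))) (n - 1) := by
    have hzm : z j₀ ∈ maximalIdeal _ := by rw [← hzspan]; exact Ideal.subset_span ⟨j₀, rfl⟩
    have h1 := hup (hla (Ideal.pow_mem_pow hzm (la + 1)))
    rw [Ideal.mem_comap, map_pow, pow_succ'] at h1
    exact mem_of_mul_mem_span_singleton_mul _ hgnzd h1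
  -- `𝔪' = (g, u', x'')`, hence `𝔪' ⊆ (g) + 𝔍'` and `𝔪'^λ ⊆ 𝔍'`
  have ha₀range : Fin.castSucc (Fin.last c) ∉ Set.range (fun t : Fin c => Fin.castSucc (Fin.castSucc t)) := by
    rintro ⟨t, ht⟩
    exact (Fin.castSucc_lt_last t).ne (Fin.castSucc_injective _ ht)
  have hfull := hbig (Fin.castSucc (Fin.last c)) ha₀range hj₀a.symm (h𝔍'm hxmem)
  have h𝔪' : maximalIdeal ((T.St (m + j + 1)).presheaf.stalk (T.pt (m + (j + 1)))) ≤
      Ideal.span {((T.π (m + j)).stalkMap (T.pt (m + (j + 1)))).hom (z j₀)} ⊔ levelShadow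
        (Ideal.span (Set.range (e ∘ fun t : Fin c => Fin.castSucc (Fin.castSucc t))))
        (stalkIdeal (T.D (m + (j + 1))).ideal (T.pt (m + (j + 1)))) (n - 1) := by
    rw [← IsRsopPart.span_range_eq_maximalIdeal hfull hdimS, span_range_snoc, span_range_cons]
    refine sup_le (sup_le ?_ ?_) le_sup_left
    · rw [Ideal.span_singleton_le_iff_mem]; exact Ideal.mem_sup_right hxmem
    · exact le_sup_of_le_right (le_levelShadow _ _ _)
  have hla' : maximalIdeal ((T.St (m + j + 1)).presheaf.stalk (T.pt (m + (j + 1)))) ^ la ≤ levelShadow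
      (Ideal.span (Set.range (e ∘ fun t : Fin c => Fin.castSucc (Fin.castSucc t))))
      (stalkIdeal (T.D (m + (j + 1))).ideal (T.pt (m + (j + 1)))) (n - 1) := by
    refine (Ideal.pow_right_mono h𝔪' la).trans ((sup_pow_le_pow_sup _ _ la).trans (sup_le ?_ le_rfl))
    rw [Ideal.span_singleton_pow, Ideal.span_singleton_le_iff_mem]
    exact hgpow
  exact ⟨_, hu', h𝔭', hdimS, hI'p, hla'⟩

/-! ## §2 LAW E and its weight-one corollaries -/

/-- **LAW E · `noTower_submaximalSurfaceHugging`** (hypothesis-free, every weight `n ≥ 1`, all characteristics):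
no infinite forced tower hugs a regular surface germ carrying the marked ideal in its `(n-1)`-st power.
[cite: Hironaka1964, Ch. III §3; Matsumura1987, Thm. 14.2, §16; CossartJannsenSaito2009, Thm. 5.31] -/
theorem noTower_submaximalSurfaceHugging {n : ℕ} (hn : 1 ≤ n) : NoTower n SubmaximalSurfaceHugging := by
  intro p _ k _ _ T g hB hD _ hS
  obtain ⟨m, H, hH, hd2, hreg, hIP⟩ := hS
  haveI := hreg
  obtain ⟨c, la, h0⟩ := shadowFrame_start T g hB hD hn hH hd2 hIP
  have key : ∀ la j, ShadowFrame T n m H j c la → False := by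
    intro la
    induction la with
    | zero => intro j h; exact shadowFrame_zero_elim T hD hn h
    | succ la ih => intro j h; exact ih (j + 1) (shadowFrame_succ T g hB hD hn hH h)
  exact key la 0 h0

/-- the weight-one instance: NO infinite forced tower of weight `1` hugs a regular surface germ at all (for `n = 1`
every hugged germ carries `I ⊆ 𝔭^0 = (1)`), i.e. `SurfaceLaw 1` and `RegularSurfaceHuggingTowersTerminate 1`
HYPOTHESIS-FREE. [cite: Hironaka1964, Ch. III §3] -/
theorem regularSurfaceHuggingTowersTerminate_one : RegularSurfaceHuggingTowersTerminate 1 := by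
  intro p hp k _ _ T g hB hD hE hS
  obtain ⟨m, H, hH, hd2, hreg⟩ := hS
  refine noTower_submaximalSurfaceHugging le_rfl p hp k T g hB hD hE ⟨m, H, hH, hd2, hreg, ?_⟩
  rw [tower_mult_eq T hD m, Nat.sub_self, pow_zero, Ideal.one_eq_top]
  exact le_top

/-- `SurfaceLaw 1`, hypothesis-free. [cite: Hironaka1964, Ch. III §3] -/
theorem surfaceLaw_one : SurfaceLaw 1 :=
  surfaceLaw_iff_noTower.mpr regularSurfaceHuggingTowersTerminate_one

end Tower

end Summit.ResolutionOfSingularities.ResolutionOfSingularities.Theorems.HugValuationCut
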